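import Literature.NumberTheory.GaloisRepresentations.ContinuousCorestriction
import HarnessLib

/-!
# `res_D ∘ cor_{N}^{G} = cor_{D ∩ N}^{D} ∘ res` on continuous `H¹` when `D · N = G`
# (the one-double-coset case of the double coset formula), complement to `ContinuousCorestriction.lean`

Generic continuous group cohomology (no number theory).  For a topological group `G`, a topological
representation `X` of `G`, an open subgroup `N ≤ G` of finite index and ANY subgroup `D ≤ G` with
`D · N = G` (every coset of `N` meets `D`), the double coset space `D \ G / N` is a point and the double
coset formula for `res ∘ cor` (Neukirch–Schmidt–Wingberg (1.5.6)–(1.5.7)) has a single term: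

  `res_{G → D} (cor_{N → G} ξ) = cor_{D ∩ N → D} (res_{N → D ∩ N} ξ)`   on `H¹(N, X)`

(`resSubgroup_cores_eq_cores_subgroupOf`).  On cocycles this is an EQUALITY once the representatives of
`G ⧸ N` are chosen inside `D` (they are then representatives of `D ⧸ (D ∩ N)` along the bijection
`D ⧸ (D ∩ N) → G ⧸ N`), because the tree's `cores` does not depend on the representatives
(`cores_oneCocycleClass`).  `D` need not be open, normal, or of finite index: the typical use is a
decomposition group `D = D_v ≤ Γ_K` and `N = Gal(K̄/K_n)` a layer of a `ℤ_p`-extension in which `v` is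
totally ramified (`D_v · N = Γ_K`), where it gives the compatibility of the Shapiro map
`cor ∘ (m ↦ m·T⁰) : H¹(K_n, M) → H¹(K, 𝒯_{p^n})` with localisation at `v`.
Cell `bsd-smallim` (rung K6 of `BirchSwinnertonDyer`, crux `MuTransferX9` = item 19276), seat
`bsd-smallim-k6-c2` (gen 3), toward the registered stub `stub_selmerDualOdd` (local condition at `p`).
No new objects, no named facts, no `sorry`.

References: J. Neukirch, A. Schmidt, K. Wingberg, *Cohomology of Number Fields*, 2nd ed. (2008), I §5
(1.5.6)–(1.5.7) (cor on cochains; the double coset formula) [NeukirchSchmidtWingberg2008];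
K. S. Brown, *Cohomology of Groups* (1982), III (9.5) (b) (Mackey / double coset formula) [Brown1982];
J.-P. Serre, *Local Fields* (1979), VII §7 [SerreLocalFields1979].
-/

noncomputable section

open CategoryTheory

universe u v

namespace Literature.NumberTheory.GaloisRepresentations

open Literature.NumberTheory.EllipticCurves (schreierElt schreierElt_mem schreierElt_coe
  subgroupInclusion subgroupInclusion_apply_coe)

variable {R : Type u} [Ring R] [TopologicalSpace R]
variable {G : Type v} [Group G] [TopologicalSpace G] [IsTopologicalGroup G]
variable (X : TopRep.{v} R G) {N : Subgroup G} (D : Subgroup G)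

omit [TopologicalSpace G] [IsTopologicalGroup G] in
/-- If every coset of `N` meets `D`, the representatives of `G ⧸ N` can be chosen inside `D`.
[cite: NeukirchSchmidtWingberg2008, I §5 (1.5.6)–(1.5.7)] -/
theorem exists_rep_mem_of_forall_exists (hDN : ∀ g : G, ∃ d ∈ D, d⁻¹ * g ∈ N) :
    ∃ s : G ⧸ N → G, (∀ x, s x ∈ D) ∧ ∀ x, (s x : G ⧸ N) = x := by
  have hrep : ∀ x : G ⧸ N, ∃ d : G, d ∈ D ∧ (d : G ⧸ N) = x := fun x => by
    obtain ⟨d, hd, hdx⟩ := hDN (Quotient.out x)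
    refine ⟨d, hd, ?_⟩
    rw [← QuotientGroup.out_eq' x]
    exact QuotientGroup.eq.mpr hdx
  choose s hsD hs using hrep
  exact ⟨s, hsD, hs⟩

/-- **`res ∘ cor` with one double coset**: for an open subgroup `N ≤ G` of finite index and a subgroup
`D ≤ G` with `D · N = G`, `res_{G → D} (cor_{N → G} ξ) = cor_{D ∩ N → D} (res_{N → D ∩ N} ξ)` on
`H¹(N, X)` — the right-hand side being the corestriction of the group `D` along its open subgroup
`(D ⊓ N).subgroupOf D` applied to the tautological image (`toSubgroupOf`) of the restriction of `ξ` to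
`D ⊓ N`.  The finiteness of `D ⧸ (D ∩ N)` (in bijection with `G ⧸ N`) is an instance binder.
[cite: NeukirchSchmidtWingberg2008, I §5 (1.5.6)–(1.5.7)] [cite: Brown1982, III (9.5) (b)] -/
theorem resSubgroup_cores_eq_cores_subgroupOf (hN : IsOpen (N : Set G)) [Fintype (G ⧸ N)]
    (hDN : ∀ g : G, ∃ d ∈ D, d⁻¹ * g ∈ N)
    (hopen : IsOpen (((D ⊓ N).subgroupOf D : Subgroup D) : Set D))
    [Fintype (D ⧸ (D ⊓ N).subgroupOf D)] (ξ : continuousCohomology 1 (subgroupRep X N)) :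
    resSubgroup X D 1 (cores X N hN ξ) =
      cores (subgroupRep X D) ((D ⊓ N).subgroupOf D) hopen
        (toSubgroupOf X (inf_le_left : D ⊓ N ≤ D) 1
          (resLe X (inf_le_right : D ⊓ N ≤ N) 1 ξ)) := by
  classical
  obtain ⟨s, hsD, hs⟩ := exists_rep_mem_of_forall_exists D hDN
  -- the induced map `ι : D ⧸ (D ∩ N) → G ⧸ N`, a `D`-equivariant bijection
  have hmem : ∀ x : D, x ∈ (D ⊓ N).subgroupOf D ↔ (x : G) ∈ N := fun x => by
    rw [Subgroup.mem_subgroupOf, Subgroup.mem_inf]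
    exact ⟨fun h => h.2, fun h => ⟨x.2, h⟩⟩
  let ι : D ⧸ (D ⊓ N).subgroupOf D → G ⧸ N :=
    Quotient.map' (fun d : D => (d : G)) fun a b hab => by
      rw [QuotientGroup.leftRel_apply] at hab ⊢
      have h := (hmem _).mp hab
      simpa using h
  have hι_mk : ∀ d : D, ι (QuotientGroup.mk d) = QuotientGroup.mk (d : G) := fun d => rfl
  have hι_smul : ∀ (d : D) (y : D ⧸ (D ⊓ N).subgroupOf D), ι (d • y) = (d : G) • ι y := by
    intro d y
    induction y using QuotientGroup.induction_on with
    | H e => rfl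
  have hι_inj : Function.Injective ι := by
    intro y₁ y₂ h
    induction y₁ using QuotientGroup.induction_on with
    | H d₁ =>
      induction y₂ using QuotientGroup.induction_on with
      | H d₂ =>
        rw [hι_mk, hι_mk, QuotientGroup.eq] at h
        refine QuotientGroup.eq.mpr ((hmem _).mpr ?_)
        simpa using h
  have hι_surj : Function.Surjective ι := fun x =>
    ⟨QuotientGroup.mk ⟨s x, hsD x⟩, by rw [hι_mk]; exact hs x⟩
  -- representatives of `D ⧸ (D ∩ N)` matched with `s` along `ι`
  let s' : D ⧸ (D ⊓ N).subgroupOf D → D := fun y => ⟨s (ι y), hsD (ι y)⟩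
  have hs'coe : ∀ y, ((s' y : D) : G) = s (ι y) := fun y => rfl
  have hs' : ∀ y, (s' y : D ⧸ (D ⊓ N).subgroupOf D) = y := fun y =>
    hι_inj (by rw [hι_mk, hs'coe]; exact hs (ι y))
  -- both sides on cocycles
  obtain ⟨φ, rfl⟩ := oneCocycleClass_surjective _ ξ
  rw [cores_oneCocycleClass X N hN hs φ, resSubgroup_oneCocycleClass, resLe_oneCocycleClass]
  change _ = cores _ _ _ (toSubgroupOf X _ 1 (oneCocycleClass _ _))
  rw [toSubgroupOf, map_oneCocycleClass, cores_oneCocycleClass _ _ hopen hs']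
  congr 1
  apply Subtype.ext
  ext d
  rw [contOneCocycles.pullback_apply, TopRep.hom_ofHom, transferCocycle_apply, transferFun_apply]
  change (transferCocycle X N hN hs φ).1 (d : G) = _
  rw [transferCocycle_apply, transferFun_apply]
  symm
  refine Fintype.sum_bijective ι ⟨hι_inj, hι_surj⟩ _ _ fun y => ?_
  rw [subgroupRep_ρ_apply, hs'coe, hι_smul]
  congr 1
  rw [contOneCocycles.pullback_apply, TopRep.hom_ofHom, contOneCocycles.pullback_apply,
    TopRep.hom_ofHom]
  change φ.1 _ = φ.1 _
  congr 1
  apply Subtype.ext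
  rw [subgroupInclusion_apply_coe, subgroupOfHom_apply_coe, schreierElt_coe, schreierElt_coe]
  push_cast
  rw [hs'coe, hs'coe, hι_smul]

/-- In particular a class of `H¹(N, X)` whose restriction to `D ∩ N` vanishes has corestriction
vanishing on `D`: `res_{N → D∩N} ξ = 0 ⟹ res_{G → D} (cor_{N → G} ξ) = 0` (when `D · N = G`).
[cite: NeukirchSchmidtWingberg2008, I §5 (1.5.6)–(1.5.7)] -/
theorem resSubgroup_cores_eq_zero_of_resLe_eq_zero (hN : IsOpen (N : Set G)) [Fintype (G ⧸ N)]
    (hDN : ∀ g : G, ∃ d ∈ D, d⁻¹ * g ∈ N)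
    (hopen : IsOpen (((D ⊓ N).subgroupOf D : Subgroup D) : Set D))
    [Fintype (D ⧸ (D ⊓ N).subgroupOf D)] {ξ : continuousCohomology 1 (subgroupRep X N)}
    (h0 : resLe X (inf_le_right : D ⊓ N ≤ N) 1 ξ = 0) :
    resSubgroup X D 1 (cores X N hN ξ) = 0 := by
  rw [resSubgroup_cores_eq_cores_subgroupOf X D hN hDN hopen, h0, map_zero, map_zero]

end Literature.NumberTheory.GaloisRepresentations

end
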